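import Mathlib
import HarnessLib
import Summits.AtomisticToContinuum.FouriersLaw.Theses.JunctionLocality
import Summits.AtomisticToContinuum.FouriersLaw.Theorems.JunctionLocalitySuperadditiveResistanceStubProbeRemovalCostAux3

/-!
# Probe-removal cost in the κ-frame, helper V: the probe-removal identities WITHOUT any regularity hypothesis
# (improper junction Dirichlet pairings as cutoff limits)
(helper `--supports` stmt-AtomisticToContinuum-11748 for stub `stub_probeRemovalCost` (S3') of line
`floating-probe-bypass-laplacian`, skeleton v7/v8, crux `JunctionLocality.SuperadditiveResistance`)

Helpers III/IV wrote `a − G_L`, `b − G_L`, `G_L − x` as junction pairings `Π(h, g) = κ⟨h∘R, g⟩ + γT Σ_{s∈{N−1,N}}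
⟨∂_{p_s}(h∘R), ∂_{p_s} g⟩` under the hypothesis that the PLAIN field's junction momentum gradients are square integrable —
not known at interior sites. This file removes the hypothesis: the junction Dirichlet pairing always exists as an IMPROPER
integral, the limit of the energy-cutoff pairings `D_n(h, g) = Σ_{s∈{N−1,N}} ∫ χ_n ∂_{p_s}(h∘R) ∂_{p_s} g dμ_T`
(`χ_n = Kubo.chi`, the landed smooth cutoffs `φ(H/(n+1)) ↑ 1`), and the four identities hold with
`Π^lim(h, g) := κ⟨h∘R, g⟩ + γT · lim_n D_n(h, g)` (`limUnder atTop`, written out in full; no definition is introduced):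

* `tendsto_plainPair_resolvent_pairing_measure` — for a plain pair `L^{T,T} h = −(kin t − T)` (`h ∈ C² ∩ L²(μ_T)`) and a
  device resolvent field `κ g − L_dev g = kin s − T`: `κ⟨h∘R, g⟩ + γT D_n(h, g) → ⟨h, kin s − T⟩ − ⟨g, kin t − T⟩`
  (helper III's cutoff form, in the Gibbs MEASURE); `plainPair_resolvent_pairing_lim` — hence
  `⟨h, kin s − T⟩ − ⟨g, kin t − T⟩ = Π^lim(h, g)` UNCONDITIONALLY;
* `limUnder_cutoffJunctionDirichlet_eq` — if `∂_{p_{N−1}} h, ∂_{p_N} h ∈ L²(μ_T)` then `lim_n D_n(h, g)` IS the junction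
  Dirichlet pairing `Σ_s ⟨∂_{p_s}(h∘R), ∂_{p_s} g⟩` of helpers III/IV (dominated convergence);
* (I0^lim) `kuboMatrix_zero_zero_sub_plainKubo_lim` `K₀₀ − G_L = c Π^lim(gL, g 0)`, (I3^lim)
  `plainKubo_add_kuboMatrix_three_zero_lim` `G_L + K₃₀ = c Π^lim(gL, g 3)`, (I3'^lim)
  `kuboMatrix_three_three_sub_plainKubo_lim` `K₃₃ − G_L = c Π^lim(gL∘S, g 3)`, (I0'^lim)
  `plainKubo_add_kuboMatrix_zero_three_lim` `G_L + K₀₃ = c Π^lim(gL∘S, g 0)` (`c = γ²/T²`, `S` the site reflection) —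
  for EVERY resolvent field and EVERY plain forward field, no regularity assumed (`helper_probeRemovalLimIdentity` is the
  registered one-line form of (I0^lim)).

So the `N`-uniform content of S3' can be isolated with no hypothesis at all (helper VI). Fixed-`N` statements; standard
axioms; no definitions; nothing taken as a named fact.
-/

noncomputable section

open MeasureTheory Filter Topology
open scoped ContDiff
open Literature.MathematicalPhysics.KineticTheory.HeatConduction
open Summit.AtomisticToContinuum.FouriersLaw.Theorems.SuperadditiveResistance.DeviceLiouville
  (kin deviceGenerator deviceWeight deviceGenerator_eq kin_eq_sq liouvilleOp bathOp generator_eq_liouvilleOp_add)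
open Summit.AtomisticToContinuum.FouriersLaw.Theorems.SuperadditiveResistance.Kubo
  (rev rev_apply contDiff_rev continuous_rev memLp_rev partialP_rev_eq chi contDiff_chi
    memLp_partialP integrable_mul_mul_gibbsDensity tendsto_integral_chi_mul)
open Summit.AtomisticToContinuum.FouriersLaw.Cruxes.SuperadditiveResistance.ThermaliseThenCutProbeInsertion
  (plainField_endPairing)

namespace Summit.AtomisticToContinuum.FouriersLaw.Cruxes.SuperadditiveResistance.FloatingProbeBypassLaplacian

/-! ## §1 The cutoff junction pairings in the Gibbs measure and their limit -/

section Limit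

variable {ω₂ lam β γ T : ℝ} {N M : ℕ}

/-- The probe site `N−1` carries a positive thermostat weight of the device. -/
theorem deviceWeight_pos_of_val_eq_pred {i : Fin (N + M)} (hi : i.val = N - 1) : 0 < deviceWeight N M i := by
  unfold deviceWeight OscillatorChain.bathWeight
  rw [if_pos hi]
  have h0 : 0 ≤ (if i.val = 0 then (1 : ℝ) else 0) := by split_ifs <;> norm_num
  have h1 : 0 ≤ (if i.val = N + M - 1 then (1 : ℝ) else 0) := by split_ifs <;> norm_num
  have h3 : 0 ≤ (if i.val = N then (1 : ℝ) else 0) := by split_ifs <;> norm_num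
  linarith

/-- The probe site `N` carries a positive thermostat weight of the device. -/
theorem deviceWeight_pos_of_val_eq_self {i : Fin (N + M)} (hi : i.val = N) : 0 < deviceWeight N M i := by
  unfold deviceWeight OscillatorChain.bathWeight
  rw [if_pos hi]
  have h0 : 0 ≤ (if i.val = 0 then (1 : ℝ) else 0) := by split_ifs <;> norm_num
  have h1 : 0 ≤ (if i.val = N + M - 1 then (1 : ℝ) else 0) := by split_ifs <;> norm_num
  have h2 : 0 ≤ (if i.val = N - 1 then (1 : ℝ) else 0) := by split_ifs <;> norm_num
  linarith

/-- **The cutoff junction pairings converge, in the Gibbs MEASURE (no regularity hypothesis; fixed `N`, `M ≥ 1`, `κ`).**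
For `h ∈ C² ∩ L²(μ_T)` with `L^{T,T} h = −(kin t − T)` and a `κ`-resolvent field `g` of the device for site `s`:
`κ⟨h∘R, g⟩ + γT Σ_{s'∈{N−1,N}} ∫ χ_n ∂_{p_{s'}}(h∘R) ∂_{p_{s'}} g dμ_T ⟶ ⟨h, kin s − T⟩ − ⟨g, kin t − T⟩`. -/
theorem tendsto_plainPair_resolvent_pairing_measure (hω : 0 < ω₂) (hl : 0 ≤ lam) (hβ : 0 ≤ β) (hγ : 0 < γ)
    (hT : 0 < T) (hM : 1 ≤ M) {κ : ℝ} {s : ℕ} (t : ℕ) {g : PhaseSpace (N + M) → ℝ}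
    (hg : g ∈ deviceResolventFields ω₂ lam β γ T N M s κ) {h : PhaseSpace (N + M) → ℝ} (hhC : ContDiff ℝ 2 h)
    (hhL : MemLp h 2 ((pinnedChain ω₂ lam β γ).gibbsMeasure (N + M) T))
    (hpdeh : ∀ x, (pinnedChain ω₂ lam β γ).generator (N + M) T T h x = -(kin (N + M) t x - T)) :
    Tendsto (fun n : ℕ => κ * ∫ x, h (x.1, -x.2) * g x ∂((pinnedChain ω₂ lam β γ).gibbsMeasure (N + M) T) +
        γ * T * ((∫ x, chi (pinnedChain ω₂ lam β γ) (N + M) n x * (partialP ⟨N - 1, by omega⟩ (rev h) x * partialP ⟨N - 1, by omega⟩ (g) x) ∂((pinnedChain ω₂ lam β γ).gibbsMeasure (N + M) T)) +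
            ∫ x, chi (pinnedChain ω₂ lam β γ) (N + M) n x * (partialP ⟨N, by omega⟩ (rev h) x * partialP ⟨N, by omega⟩ (g) x) ∂((pinnedChain ω₂ lam β γ).gibbsMeasure (N + M) T))) atTop
      (𝓝 ((∫ x, h x * (kin (N + M) s x - T) ∂((pinnedChain ω₂ lam β γ).gibbsMeasure (N + M) T)) -
        ∫ x, g x * (kin (N + M) t x - T) ∂((pinnedChain ω₂ lam β γ).gibbsMeasure (N + M) T))) := by
  have hlim := tendsto_plainPair_resolvent_pairing hω hl hβ hγ hT hM t hg hhC hhL hpdeh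
  set P := pinnedChain ω₂ lam β γ with hP
  simp only [P.integral_gibbsMeasure]
  have e1 : ∀ n : ℕ, ∫ x, chi P (N + M) n x * (partialP ⟨N - 1, by omega⟩ (rev h) x * partialP ⟨N - 1, by omega⟩ g x) *
      P.gibbsDensity (N + M) T x = ∫ x, chi P (N + M) n x * (partialP ⟨N - 1, by omega⟩ g x *
        partialP ⟨N - 1, by omega⟩ (rev h) x) * P.gibbsDensity (N + M) T x :=
    fun n => integral_congr_ae (ae_of_all _ fun x => by ring)
  have e2 : ∀ n : ℕ, ∫ x, chi P (N + M) n x * (partialP ⟨N, by omega⟩ (rev h) x * partialP ⟨N, by omega⟩ g x) *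
      P.gibbsDensity (N + M) T x = ∫ x, chi P (N + M) n x * (partialP ⟨N, by omega⟩ g x *
        partialP ⟨N, by omega⟩ (rev h) x) * P.gibbsDensity (N + M) T x :=
    fun n => integral_congr_ae (ae_of_all _ fun x => by ring)
  simp only [e1, e2]
  have key := (hlim.const_mul (∫ x, P.gibbsDensity (N + M) T x)⁻¹).const_add
    (κ * ((∫ x, P.gibbsDensity (N + M) T x)⁻¹ * ∫ x, h (x.1, -x.2) * g x * P.gibbsDensity (N + M) T x))
  convert key using 2
  · ring
  · ring

/-- **THE MASTER PAIRING, LIMIT FORM (unconditional).** In the setting of `tendsto_plainPair_resolvent_pairing_measure`: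
`⟨h, kin s − T⟩ − ⟨g, kin t − T⟩ = κ⟨h∘R, g⟩ + γT · lim_n Σ_{s'∈{N−1,N}} ∫ χ_n ∂_{p_{s'}}(h∘R) ∂_{p_{s'}} g dμ_T`
(`limUnder atTop`; the limit exists by the previous theorem). -/
theorem plainPair_resolvent_pairing_lim (hω : 0 < ω₂) (hl : 0 ≤ lam) (hβ : 0 ≤ β) (hγ : 0 < γ) (hT : 0 < T)
    (hM : 1 ≤ M) {κ : ℝ} {s : ℕ} (t : ℕ) {g : PhaseSpace (N + M) → ℝ}
    (hg : g ∈ deviceResolventFields ω₂ lam β γ T N M s κ) {h : PhaseSpace (N + M) → ℝ} (hhC : ContDiff ℝ 2 h)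
    (hhL : MemLp h 2 ((pinnedChain ω₂ lam β γ).gibbsMeasure (N + M) T))
    (hpdeh : ∀ x, (pinnedChain ω₂ lam β γ).generator (N + M) T T h x = -(kin (N + M) t x - T)) :
    (∫ x, h x * (kin (N + M) s x - T) ∂((pinnedChain ω₂ lam β γ).gibbsMeasure (N + M) T)) -
        ∫ x, g x * (kin (N + M) t x - T) ∂((pinnedChain ω₂ lam β γ).gibbsMeasure (N + M) T) =
      (κ * ∫ x, h (x.1, -x.2) * g x ∂((pinnedChain ω₂ lam β γ).gibbsMeasure (N + M) T) +
        γ * T * limUnder atTop (fun n : ℕ =>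
          ((∫ x, chi (pinnedChain ω₂ lam β γ) (N + M) n x * (partialP ⟨N - 1, by omega⟩ (rev h) x * partialP ⟨N - 1, by omega⟩ (g) x) ∂((pinnedChain ω₂ lam β γ).gibbsMeasure (N + M) T)) +
            ∫ x, chi (pinnedChain ω₂ lam β γ) (N + M) n x * (partialP ⟨N, by omega⟩ (rev h) x * partialP ⟨N, by omega⟩ (g) x) ∂((pinnedChain ω₂ lam β γ).gibbsMeasure (N + M) T)))) := by
  have h1 := tendsto_plainPair_resolvent_pairing_measure hω hl hβ hγ hT hM t hg hhC hhL hpdeh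
  have hγT : γ * T ≠ 0 := by positivity
  set A := (∫ x, h x * (kin (N + M) s x - T) ∂((pinnedChain ω₂ lam β γ).gibbsMeasure (N + M) T)) -
    ∫ x, g x * (kin (N + M) t x - T) ∂((pinnedChain ω₂ lam β γ).gibbsMeasure (N + M) T) with hA
  set m := ∫ x, h (x.1, -x.2) * g x ∂((pinnedChain ω₂ lam β γ).gibbsMeasure (N + M) T) with hm
  have h2 : Tendsto (fun n : ℕ =>
      ((∫ x, chi (pinnedChain ω₂ lam β γ) (N + M) n x * (partialP ⟨N - 1, by omega⟩ (rev h) x * partialP ⟨N - 1, by omega⟩ (g) x) ∂((pinnedChain ω₂ lam β γ).gibbsMeasure (N + M) T)) +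
        ∫ x, chi (pinnedChain ω₂ lam β γ) (N + M) n x * (partialP ⟨N, by omega⟩ (rev h) x * partialP ⟨N, by omega⟩ (g) x) ∂((pinnedChain ω₂ lam β γ).gibbsMeasure (N + M) T))) atTop (𝓝 ((A - κ * m) / (γ * T))) := by
    refine ((h1.sub_const (κ * m)).div_const (γ * T)).congr fun n => ?_
    field_simp
    ring
  rw [h2.limUnder_eq]
  field_simp
  ring

/-- **The improper junction Dirichlet pairing is the proper one under junction-gradient regularity.** If
`∂_{p_{N−1}} h, ∂_{p_N} h ∈ L²(μ_T)` (and `h ∈ C²`), then for every device resolvent field `g`: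
`lim_n Σ_{s∈{N−1,N}} ∫ χ_n ∂_{p_s}(h∘R) ∂_{p_s} g dμ_T = Σ_{s∈{N−1,N}} ⟨∂_{p_s}(h∘R), ∂_{p_s} g⟩_{μ_T}` (dominated convergence; the
device field's probe gradients are square integrable because the probes are thermostats of the device). -/
theorem limUnder_cutoffJunctionDirichlet_eq (hω : 0 < ω₂) (hl : 0 ≤ lam) (hβ : 0 ≤ β) (hγ : 0 < γ) (hT : 0 < T)
    (hM : 1 ≤ M) {κ : ℝ} {s : ℕ} {g : PhaseSpace (N + M) → ℝ} (hg : g ∈ deviceResolventFields ω₂ lam β γ T N M s κ)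
    {h : PhaseSpace (N + M) → ℝ} (hhC : ContDiff ℝ 2 h)
    (hreg₁ : MemLp (partialP ⟨N - 1, by omega⟩ h) 2 ((pinnedChain ω₂ lam β γ).gibbsMeasure (N + M) T))
    (hreg₂ : MemLp (partialP ⟨N, by omega⟩ h) 2 ((pinnedChain ω₂ lam β γ).gibbsMeasure (N + M) T)) :
    limUnder atTop (fun n : ℕ =>
        ((∫ x, chi (pinnedChain ω₂ lam β γ) (N + M) n x * (partialP ⟨N - 1, by omega⟩ (rev h) x * partialP ⟨N - 1, by omega⟩ (g) x) ∂((pinnedChain ω₂ lam β γ).gibbsMeasure (N + M) T)) +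
          ∫ x, chi (pinnedChain ω₂ lam β γ) (N + M) n x * (partialP ⟨N, by omega⟩ (rev h) x * partialP ⟨N, by omega⟩ (g) x) ∂((pinnedChain ω₂ lam β γ).gibbsMeasure (N + M) T))) =
      (∫ x, partialP ⟨N - 1, by omega⟩ (rev h) x * partialP ⟨N - 1, by omega⟩ g x
          ∂((pinnedChain ω₂ lam β γ).gibbsMeasure (N + M) T)) +
        ∫ x, partialP ⟨N, by omega⟩ (rev h) x * partialP ⟨N, by omega⟩ g x
          ∂((pinnedChain ω₂ lam β γ).gibbsMeasure (N + M) T) := by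
  obtain ⟨hgC, hgL, hpde⟩ := hg
  set P := pinnedChain ω₂ lam β γ with hP
  have hrevC : ContDiff ℝ 2 (rev h) := contDiff_rev hhC
  have hdrev : ∀ j : Fin (N + M), MemLp (partialP j h) 2 (P.gibbsMeasure (N + M) T) →
      MemLp (partialP j (rev h)) 2 (P.gibbsMeasure (N + M) T) := by
    intro j hj
    rw [partialP_rev_eq]
    exact (memLp_rev hω hl hβ (N + M) hT (continuous_partialP hhC two_ne_zero j) hj).neg
  have hkf : MemLp (fun x : PhaseSpace (N + M) => (kin (N + M) s x - T) - κ * g x) 2 (P.gibbsMeasure (N + M) T) :=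
    (memLp_kin_sub hω hl hβ γ (N + M) s hT).sub (hgL.const_mul κ)
  have hpde' : ∀ x, 1 * liouvilleOp P (N + M) g x + γ * bathOp (N + M) (deviceWeight N M) T g x =
      -((kin (N + M) s x - T) - κ * g x) := fun x => by
    rw [deviceWeight_eq_add]; exact deviceResolvent_pair_add κ s hpde x
  have hdg : ∀ j : Fin (N + M), 0 < deviceWeight N M j → MemLp (partialP j g) 2 (P.gibbsMeasure (N + M) T) :=
    fun j hj =>
    memLp_partialP hω hl hβ γ (N + M) hT (deviceWeight N M) (deviceWeight_nonneg' N M) 1 hγ hgC hgL hkf hpde' hj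
  have hg₁ := hdg ⟨N - 1, by omega⟩ (deviceWeight_pos_of_val_eq_pred rfl)
  have hg₂ := hdg ⟨N, by omega⟩ (deviceWeight_pos_of_val_eq_self rfl)
  have hh₁ := hdrev _ hreg₁
  have hh₂ := hdrev _ hreg₂
  have hc₁ : Continuous fun x => partialP ⟨N - 1, by omega⟩ (rev h) x * partialP ⟨N - 1, by omega⟩ g x :=
    (continuous_partialP hrevC two_ne_zero _).mul (continuous_partialP hgC two_ne_zero _)
  have hc₂ : Continuous fun x => partialP ⟨N, by omega⟩ (rev h) x * partialP ⟨N, by omega⟩ g x :=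
    (continuous_partialP hrevC two_ne_zero _).mul (continuous_partialP hgC two_ne_zero _)
  have hI₁ := integrable_mul_mul_gibbsDensity hω hl hβ γ (N + M) hT hh₁ hg₁
  have hI₂ := integrable_mul_mul_gibbsDensity hω hl hβ γ (N + M) hT hh₂ hg₂
  have hl₁ := tendsto_integral_chi_mul hω.le hl hβ γ (N + M) T hc₁.aestronglyMeasurable
    (hI₁.congr (ae_of_all _ fun x => by ring))
  have hl₂ := tendsto_integral_chi_mul hω.le hl hβ γ (N + M) T hc₂.aestronglyMeasurable
    (hI₂.congr (ae_of_all _ fun x => by ring))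
  refine Tendsto.limUnder_eq ?_
  simp only [P.integral_gibbsMeasure]
  have key := (hl₁.const_mul (∫ x, P.gibbsDensity (N + M) T x)⁻¹).add
    (hl₂.const_mul (∫ x, P.gibbsDensity (N + M) T x)⁻¹)
  convert key using 2

end Limit

/-! ## §2 The four κ-frame probe-removal identities, LIMIT FORM (no regularity hypothesis) -/

section Identities

variable {ω₂ lam β γ T : ℝ} {N M : ℕ}

/-- **(I0, limit form; unconditional).** For a `κ`-resolvent field `g 0` of bath `0` and ANY plain forward field `gL` of the
whole chain (`M ≥ 1`): `K₀₀(κ) − G_L = (γ²/T²)·(κ⟨gL∘R, g 0⟩ + γT · lim_n Σ_{s∈{N−1,N}} ∫ χ_n ∂_{p_s}(gL∘R) ∂_{p_s}(g 0) dμ_T)`. -/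
theorem kuboMatrix_zero_zero_sub_plainKubo_lim (hω : 0 < ω₂) (hl : 0 ≤ lam) (hβ : 0 ≤ β) (hγ : 0 < γ)
    (hT : 0 < T) (hM : 1 ≤ M) (κ : ℝ) (g : Fin 4 → PhaseSpace (N + M) → ℝ) (gL : PhaseSpace (N + M) → ℝ)
    (hg₀ : g 0 ∈ deviceResolventFields ω₂ lam β γ T N M 0 κ) (hgL : gL ∈ plainForwardFields ω₂ lam β γ T (N + M)) :
    kuboMatrix ω₂ lam β γ T N M g 0 0 - plainKubo ω₂ lam β γ T (N + M) gL = γ ^ 2 / T ^ 2 *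
      (κ * ∫ x, gL (x.1, -x.2) * g 0 x ∂((pinnedChain ω₂ lam β γ).gibbsMeasure (N + M) T) +
        γ * T * limUnder atTop (fun n : ℕ =>
          ((∫ x, chi (pinnedChain ω₂ lam β γ) (N + M) n x * (partialP ⟨N - 1, by omega⟩ (rev gL) x * partialP ⟨N - 1, by omega⟩ (g 0) x) ∂((pinnedChain ω₂ lam β γ).gibbsMeasure (N + M) T)) +
            ∫ x, chi (pinnedChain ω₂ lam β γ) (N + M) n x * (partialP ⟨N, by omega⟩ (rev gL) x * partialP ⟨N, by omega⟩ (g 0) x) ∂((pinnedChain ω₂ lam β γ).gibbsMeasure (N + M) T)))) := by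
  obtain ⟨hgLC, hgLL, -, hpdeL⟩ := hgL
  have hD := plainPair_resolvent_pairing_lim hω hl hβ hγ hT hM 0 hg₀ hgLC hgLL hpdeL
  rw [kuboMatrix_zero_zero_eq, plainKubo]
  linear_combination (γ ^ 2 / T ^ 2) * hD

/-- **(I3, limit form; unconditional; `β > 0`, `N, M ≥ 1`).** With the `κ`-resolvent field `g 3` of the far bath:
`G_L + K₃₀(κ) = (γ²/T²)·(κ⟨gL∘R, g 3⟩ + γT · lim_n Σ_s ∫ χ_n ∂_{p_s}(gL∘R) ∂_{p_s}(g 3) dμ_T)` (far-end sum rule). -/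
theorem plainKubo_add_kuboMatrix_three_zero_lim (hω : 0 < ω₂) (hl : 0 ≤ lam) (hβ : 0 < β) (hγ : 0 < γ)
    (hT : 0 < T) (hN : 1 ≤ N) (hM : 1 ≤ M) (κ : ℝ) (g : Fin 4 → PhaseSpace (N + M) → ℝ)
    (gL : PhaseSpace (N + M) → ℝ) (hg₃ : g 3 ∈ deviceResolventFields ω₂ lam β γ T N M (N + M - 1) κ)
    (hgL : gL ∈ plainForwardFields ω₂ lam β γ T (N + M)) :
    plainKubo ω₂ lam β γ T (N + M) gL + kuboMatrix ω₂ lam β γ T N M g 3 0 = γ ^ 2 / T ^ 2 *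
      (κ * ∫ x, gL (x.1, -x.2) * g 3 x ∂((pinnedChain ω₂ lam β γ).gibbsMeasure (N + M) T) +
        γ * T * limUnder atTop (fun n : ℕ =>
          ((∫ x, chi (pinnedChain ω₂ lam β γ) (N + M) n x * (partialP ⟨N - 1, by omega⟩ (rev gL) x * partialP ⟨N - 1, by omega⟩ (g 3) x) ∂((pinnedChain ω₂ lam β γ).gibbsMeasure (N + M) T)) +
            ∫ x, chi (pinnedChain ω₂ lam β γ) (N + M) n x * (partialP ⟨N, by omega⟩ (rev gL) x * partialP ⟨N, by omega⟩ (g 3) x) ∂((pinnedChain ω₂ lam β γ).gibbsMeasure (N + M) T)))) := by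
  obtain ⟨hgLC, hgLL, -, hpdeL⟩ := hgL
  have hD := plainPair_resolvent_pairing_lim hω hl hβ.le hγ hT hM 0 hg₃ hgLC hgLL hpdeL
  have hend : ∫ x, gL x * (kin (N + M) (N + M - 1) x - T) ∂((pinnedChain ω₂ lam β γ).gibbsMeasure (N + M) T) =
      T ^ 2 / γ - ∫ x, gL x * (kin (N + M) 0 x - T) ∂((pinnedChain ω₂ lam β γ).gibbsMeasure (N + M) T) :=
    plainField_endPairing hω hl hβ hγ (show 1 ≤ N + M by omega) hT hgLC hgLL hpdeL
  rw [hend] at hD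
  rw [kuboMatrix_three_zero_eq, plainKubo]
  have hkey : γ ^ 2 / T ^ 2 * (T ^ 2 / γ) = γ := by
    rw [div_mul_div_comm, div_eq_iff (by positivity)]
    ring
  linear_combination (γ ^ 2 / T ^ 2) * hD - hkey

/-- The reflected plain field: `C²`, `L²(μ_T)`, and the right bath's forward field. -/
theorem reflected_plainField (hω : 0 < ω₂) (hl : 0 ≤ lam) (hβ : 0 ≤ β) (hT : 0 < T) {L : ℕ} (hL : 1 ≤ L)
    {gL : PhaseSpace L → ℝ} (hgLC : ContDiff ℝ 2 gL) (hgLL : MemLp gL 2 ((pinnedChain ω₂ lam β γ).gibbsMeasure L T))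
    (hpdeL : ∀ x, (pinnedChain ω₂ lam β γ).generator L T T gL x = -(kin L 0 x - T)) :
    ContDiff ℝ 2 (gL ∘ siteReflection L) ∧ MemLp (gL ∘ siteReflection L) 2 ((pinnedChain ω₂ lam β γ).gibbsMeasure L T) ∧
      ∀ x, (pinnedChain ω₂ lam β γ).generator L T T (gL ∘ siteReflection L) x = -(kin L (L - 1) x - T) :=
  ⟨hgLC.comp contDiff_siteReflection,
    Theorems.SuperadditiveResistance.KuboPlain.memLp_comp_siteReflection hω hl hβ hT hgLC.continuous hgLL,
    fun x => Theorems.SuperadditiveResistance.KuboPlain.generator_comp_siteReflection_left ω₂ lam β γ T hL hpdeL x⟩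

/-- **(I3', limit form; unconditional; `N, M ≥ 1`).** With `gR := gL ∘ siteReflection` and the `κ`-resolvent field `g 3`:
`K₃₃(κ) − G_L = (γ²/T²)·(κ⟨gR∘R, g 3⟩ + γT · lim_n Σ_s ∫ χ_n ∂_{p_s}(gR∘R) ∂_{p_s}(g 3) dμ_T)`. -/
theorem kuboMatrix_three_three_sub_plainKubo_lim (hω : 0 < ω₂) (hl : 0 ≤ lam) (hβ : 0 ≤ β) (hγ : 0 < γ)
    (hT : 0 < T) (hN : 1 ≤ N) (hM : 1 ≤ M) (κ : ℝ) (g : Fin 4 → PhaseSpace (N + M) → ℝ)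
    (gL : PhaseSpace (N + M) → ℝ) (hg₃ : g 3 ∈ deviceResolventFields ω₂ lam β γ T N M (N + M - 1) κ)
    (hgL : gL ∈ plainForwardFields ω₂ lam β γ T (N + M)) :
    kuboMatrix ω₂ lam β γ T N M g 3 3 - plainKubo ω₂ lam β γ T (N + M) gL = γ ^ 2 / T ^ 2 *
      (κ * ∫ x, (gL ∘ siteReflection (N + M)) (x.1, -x.2) * g 3 x ∂((pinnedChain ω₂ lam β γ).gibbsMeasure (N + M) T) +
        γ * T * limUnder atTop (fun n : ℕ =>
          ((∫ x, chi (pinnedChain ω₂ lam β γ) (N + M) n x * (partialP ⟨N - 1, by omega⟩ (rev (gL ∘ siteReflection (N + M))) x * partialP ⟨N - 1, by omega⟩ (g 3) x) ∂((pinnedChain ω₂ lam β γ).gibbsMeasure (N + M) T)) +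
            ∫ x, chi (pinnedChain ω₂ lam β γ) (N + M) n x * (partialP ⟨N, by omega⟩ (rev (gL ∘ siteReflection (N + M))) x * partialP ⟨N, by omega⟩ (g 3) x) ∂((pinnedChain ω₂ lam β γ).gibbsMeasure (N + M) T)))) := by
  obtain ⟨hgLC, hgLL, -, hpdeL⟩ := hgL
  obtain ⟨hgRC, hgRL, hpdeR⟩ := reflected_plainField hω hl hβ hT (show 1 ≤ N + M by omega) hgLC hgLL hpdeL (γ := γ)
  have hD := plainPair_resolvent_pairing_lim hω hl hβ hγ hT hM (N + M - 1) hg₃ hgRC hgRL hpdeR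
  have hrefl : ∫ x, (gL ∘ siteReflection (N + M)) x * (kin (N + M) (N + M - 1) x - T)
        ∂((pinnedChain ω₂ lam β γ).gibbsMeasure (N + M) T) =
      ∫ x, gL x * (kin (N + M) 0 x - T) ∂((pinnedChain ω₂ lam β γ).gibbsMeasure (N + M) T) :=
    integral_comp_siteReflection_mul_kin_last (show 0 < N + M by omega) gL
  rw [hrefl] at hD
  rw [kuboMatrix_three_three_eq, plainKubo]
  linear_combination (γ ^ 2 / T ^ 2) * hD

/-- **(I0', limit form; unconditional; `β > 0`, `N, M ≥ 1`).** With `gR := gL ∘ siteReflection` and the `κ`-resolvent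
field `g 0`: `G_L + K₀₃(κ) = (γ²/T²)·(κ⟨gR∘R, g 0⟩ + γT · lim_n Σ_s ∫ χ_n ∂_{p_s}(gR∘R) ∂_{p_s}(g 0) dμ_T)`. -/
theorem plainKubo_add_kuboMatrix_zero_three_lim (hω : 0 < ω₂) (hl : 0 ≤ lam) (hβ : 0 < β) (hγ : 0 < γ)
    (hT : 0 < T) (hN : 1 ≤ N) (hM : 1 ≤ M) (κ : ℝ) (g : Fin 4 → PhaseSpace (N + M) → ℝ)
    (gL : PhaseSpace (N + M) → ℝ) (hg₀ : g 0 ∈ deviceResolventFields ω₂ lam β γ T N M 0 κ)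
    (hgL : gL ∈ plainForwardFields ω₂ lam β γ T (N + M)) :
    plainKubo ω₂ lam β γ T (N + M) gL + kuboMatrix ω₂ lam β γ T N M g 0 3 = γ ^ 2 / T ^ 2 *
      (κ * ∫ x, (gL ∘ siteReflection (N + M)) (x.1, -x.2) * g 0 x ∂((pinnedChain ω₂ lam β γ).gibbsMeasure (N + M) T) +
        γ * T * limUnder atTop (fun n : ℕ =>
          ((∫ x, chi (pinnedChain ω₂ lam β γ) (N + M) n x * (partialP ⟨N - 1, by omega⟩ (rev (gL ∘ siteReflection (N + M))) x * partialP ⟨N - 1, by omega⟩ (g 0) x) ∂((pinnedChain ω₂ lam β γ).gibbsMeasure (N + M) T)) +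
            ∫ x, chi (pinnedChain ω₂ lam β γ) (N + M) n x * (partialP ⟨N, by omega⟩ (rev (gL ∘ siteReflection (N + M))) x * partialP ⟨N, by omega⟩ (g 0) x) ∂((pinnedChain ω₂ lam β γ).gibbsMeasure (N + M) T)))) := by
  obtain ⟨hgLC, hgLL, -, hpdeL⟩ := hgL
  obtain ⟨hgRC, hgRL, hpdeR⟩ := reflected_plainField hω hl hβ.le hT (show 1 ≤ N + M by omega) hgLC hgLL hpdeL (γ := γ)
  have hD := plainPair_resolvent_pairing_lim hω hl hβ.le hγ hT hM (N + M - 1) hg₀ hgRC hgRL hpdeR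
  have hrefl : ∫ x, (gL ∘ siteReflection (N + M)) x * (kin (N + M) 0 x - T)
        ∂((pinnedChain ω₂ lam β γ).gibbsMeasure (N + M) T) =
      ∫ x, gL x * (kin (N + M) (N + M - 1) x - T) ∂((pinnedChain ω₂ lam β γ).gibbsMeasure (N + M) T) :=
    integral_comp_siteReflection_mul_kin_zero (show 0 < N + M by omega) gL
  have hend : ∫ x, gL x * (kin (N + M) (N + M - 1) x - T) ∂((pinnedChain ω₂ lam β γ).gibbsMeasure (N + M) T) =
      T ^ 2 / γ - ∫ x, gL x * (kin (N + M) 0 x - T) ∂((pinnedChain ω₂ lam β γ).gibbsMeasure (N + M) T) :=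
    plainField_endPairing hω hl hβ hγ (show 1 ≤ N + M by omega) hT hgLC hgLL hpdeL
  rw [hrefl, hend] at hD
  rw [kuboMatrix_zero_three_eq, plainKubo]
  have hkey : γ ^ 2 / T ^ 2 * (T ^ 2 / γ) = γ := by
    rw [div_mul_div_comm, div_eq_iff (by positivity)]
    ring
  linear_combination (γ ^ 2 / T ^ 2) * hD - hkey

end Identities

/-- Registered helper sub-goal `helper_probeRemovalLimIdentity` (= `kuboMatrix_zero_zero_sub_plainKubo_lim` (I0^lim) on one line,
`h∘R` written as a lambda and `Kubo.chi` fully qualified): the κ-frame probe-removal identity for `K₀₀ − G_L` with the IMPROPER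
junction pairing, no regularity hypothesis. -/
theorem helper_probeRemovalLimIdentity : ∀ {ω₂ lam β γ T : ℝ} {N M : ℕ}, 0 < ω₂ → 0 ≤ lam → 0 ≤ β → 0 < γ → 0 < T → ∀ (hM : 1 ≤ M) (κ : ℝ) (g : Fin 4 → PhaseSpace (N + M) → ℝ) (gL : PhaseSpace (N + M) → ℝ), g 0 ∈ deviceResolventFields ω₂ lam β γ T N M 0 κ → gL ∈ plainForwardFields ω₂ lam β γ T (N + M) → kuboMatrix ω₂ lam β γ T N M g 0 0 - plainKubo ω₂ lam β γ T (N + M) gL = γ ^ 2 / T ^ 2 * (κ * ∫ x, gL (x.1, -x.2) * g 0 x ∂((pinnedChain ω₂ lam β γ).gibbsMeasure (N + M) T) + γ * T * limUnder atTop (fun n : ℕ => ((∫ x, Summit.AtomisticToContinuum.FouriersLaw.Theorems.SuperadditiveResistance.Kubo.chi (pinnedChain ω₂ lam β γ) (N + M) n x * (partialP ⟨N - 1, by omega⟩ (fun y : PhaseSpace (N + M) => gL (y.1, -y.2)) x * partialP ⟨N - 1, by omega⟩ (g 0) x) ∂((pinnedChain ω₂ lam β γ).gibbsMeasure (N + M)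 T)) + ∫ x, Summit.AtomisticToContinuum.FouriersLaw.Theorems.SuperadditiveResistance.Kubo.chi (pinnedChain ω₂ lam β γ) (N + M) n x * (partialP ⟨N, by omega⟩ (fun y : PhaseSpace (N + M) => gL (y.1, -y.2)) x * partialP ⟨N, by omega⟩ (g 0) x) ∂((pinnedChain ω₂ lam β γ).gibbsMeasure (N + M) T)))) :=
  fun hω hl hβ hγ hT hM κ g gL hg₀ hgL => kuboMatrix_zero_zero_sub_plainKubo_lim hω hl hβ hγ hT hM κ g gL hg₀ hgL

end Summit.AtomisticToContinuum.FouriersLaw.Cruxes.SuperadditiveResistance.FloatingProbeBypassLaplacian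

end
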